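import Mathlib
import HarnessLib

/-!
# Heredity-constant ledger: a per-level strain constant `θ` in the marginal (Burgers-locked)
# schedule costs a Reynolds-number threshold `4/θ`, never an exponent
# (instab lane, door O-acc = O7, obstruction P3 — `HOME/instab2/HEREDITY-P3.md` (B) «PRICE, NOT KILL»)

HONEST FRAMING (cell `ns-blowup`, seat `ns-blowup-instab2`; human ruling D-0035): this cell ATTEMPTS the
negative direction of the Clay problem; nothing in this file is a claim about the Navier–Stokes equations.
WHAT THIS IS NOT: not fluid mechanics. Every declaration below is an identity or inequality between REAL
NUMBERS (an affine recursion in logarithms and its fixed point); the fluid reading of each symbol is fixed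
by the dictionary below and argued in prose in `HEREDITY-P3.md` (B) and `PTOWER-NORMALISATIONS.md` §1.
The file exists so that the census sentence of OBSTRUCTION-LIST E.3 «LEVEL-2» — «heredity costs
CONSTANTS, not exponents» — carries a kernel name and a NUMBER (the threshold `Re > 4/θ`).

## Dictionary (Palasek arXiv:2605.13827 rescaling `ν = 1`; MARGIN-LEG ML1; RATE-AUDIT §2 «Burgers lock»)

* Level `k` of the would-be tower has frequency `N_k` (inverse scale) and vorticity amplitude
  `A_k = N_k^β`, `β ∈ (2, 1+√2)` (`β* = 12/5` of record); its host Reynolds number is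
  `Re_k = A_k · N_k⁻² / ν = N_k^{β-2}`.
* MARGINAL SCHEDULE: a flux-importing level-`(k+1)` core offered the strain `σ*` sits at the Burgers
  diameter `δ_{k+1} = 2 (ν/σ*)^{1/2}` and `N_{k+1} = 1/δ_{k+1}`. On the nominal schedule the child site
  has the full level-`k` strain `σ* = A_k`, so `N_{k+1} = ½ N_k^{β/2}` — Palasek's trapping inequality
  `N_{k+1}² ≤ ¼ A_k` with EQUALITY.
* HEREDITY CONSTANT (HEREDITY-P3 (B), kernel `BurgersTubeStrainSharp`): a Gaussian level-`k` core of
  peak vorticity `A_k` offers a site OUTSIDE itself at most `σ* = θ A_k` with `θ ≤ 3/20` (one tube),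
  `≤ 3/10` (co-rotating pair), `≲ 3/5` (four tubes, HEUR). Then `δ_{k+1} = θ^{-1/2} · 2 A_k^{-1/2}`
  (fatter child) and `N_{k+1} = (√θ/2) · N_k^{β/2}`.
* In logarithms `x_k = log N_k` this is the AFFINE recursion `x_{k+1} = (β/2) x_k + log(√θ/2)` with
  ratio `r = β/2 > 1` and fixed point `L_θ = log(4/θ)/(β-2)`; `x_k > L_θ ⇔ Re_k > 4/θ`.

## What is proved

§1 the affine recursion solved exactly (`x_k − L = r^k (x₀ − L)`) with its trichotomy (above the fixed
point: strictly increasing, `→ +∞` at the unchanged double-exponential rate `r^k`; at it: constant;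
below it: strictly decreasing); §2 the dictionary identities (child frequency, child radius factor
`θ^{-1/2}`, trapping inequality only easier for `θ ≤ 1`, the fixed point in closed form, the threshold
as `Re > 4/θ`, the AMOUNT factor `θ^{(β-2)/2} ≤ 1`); §3 the numbers of record at `β* = 12/5`
(`Re`-threshold `4 → 80/3 < 27` at `θ = 3/20`, `40/3` at `3/10`, `20/3` at `3/5`; in frequencies
`N₀ > 32 → N₀ > (80/3)^{5/2} ∈ (3672, 3673)`, the same statement because `N = Re^{5/2}`; radius factor
`√(20/3) ∈ (2.58, 2.59)`). Mathlib only; no definitions. LABEL: MODEL-door bookkeeping.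
-/

namespace Summit.NavierStokesRegularity.FluidComputer.HeredityConstantLedger

section AffineRecursion

/-! ## §1 The affine recursion `x (k+1) = r · x k + c` solved, and its trichotomy

Written for arbitrary real `r ≠ 1`, `c`; the tower reading is `r = β/2`, `c = log(√θ/2)`,
`x k = log N_k`, fixed point `L = c/(1-r) = log(4/θ)/(β-2)` (§2). -/

/-- EXACT SOLUTION: `x k − L = r^k · (x 0 − L)` with `L = c/(1−r)` the fixed point of `x ↦ r x + c`.
(The heredity constant enters only through `L`; the rate `r^k` — the double-exponential growth of
`N_k = exp(x k)` — is independent of it.) -/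
theorem affine_iter_eq {r c : ℝ} (hr : r ≠ 1) {x : ℕ → ℝ} (hx : ∀ k, x (k + 1) = r * x k + c) (k : ℕ) :
    x k - c / (1 - r) = r ^ k * (x 0 - c / (1 - r)) := by
  have h1r : (1 - r) ≠ 0 := sub_ne_zero.mpr (Ne.symm hr)
  have hL : r * (c / (1 - r)) + c = c / (1 - r) := by
    field_simp
    ring
  induction k with
  | zero => simp
  | succ k ih =>
    rw [hx k, pow_succ]
    calc r * x k + c - c / (1 - r) = r * (x k - c / (1 - r)) := by linear_combination hL
      _ = r * (r ^ k * (x 0 - c / (1 - r))) := by rw [ih]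
      _ = r ^ k * r * (x 0 - c / (1 - r)) := by ring

/-- `c/(1−r)` IS a fixed point: started there, the recursion is constant (the threshold tower neither
refines nor coarsens). -/
theorem affine_iter_fixed {r c : ℝ} (hr : r ≠ 1) {x : ℕ → ℝ} (hx : ∀ k, x (k + 1) = r * x k + c)
    (h0 : x 0 = c / (1 - r)) (k : ℕ) : x k = c / (1 - r) := by
  have e := affine_iter_eq hr hx k
  rw [h0, sub_self, mul_zero] at e
  linarith

/-- ABOVE THE FIXED POINT the iterates increase strictly (`r > 1`): every level is finer than its
parent. -/
theorem affine_iter_strictMono {r c : ℝ} (hr : 1 < r) {x : ℕ → ℝ} (hx : ∀ k, x (k + 1) = r * x k + c)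
    (h0 : c / (1 - r) < x 0) : StrictMono x := by
  apply strictMono_nat_of_lt_succ
  intro k
  have e := affine_iter_eq (ne_of_gt hr) hx k
  have hk : c / (1 - r) < x k := by
    have : 0 < r ^ k * (x 0 - c / (1 - r)) := mul_pos (pow_pos (by linarith) k) (by linarith)
    linarith
  have h1r : (1 - r) ≠ 0 := ne_of_lt (by linarith)
  have key : (r - 1) * (x k - c / (1 - r)) = (r - 1) * x k + c := by
    field_simp
    ring
  have hpos : 0 < (r - 1) * (x k - c / (1 - r)) := mul_pos (by linarith) (by linarith)
  rw [hx k]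
  linarith

/-- … and the explicit lower bound `x k ≥ L + r^k (x 0 − L)` (in fact equality) exhibits the
double-exponential law `N_k = e^L · (N₀ e^{−L})^{r^k}` of the tower above threshold. -/
theorem affine_iter_ge {r c : ℝ} (hr : r ≠ 1) {x : ℕ → ℝ} (hx : ∀ k, x (k + 1) = r * x k + c) (k : ℕ) :
    c / (1 - r) + r ^ k * (x 0 - c / (1 - r)) ≤ x k := by
  have e := affine_iter_eq hr hx k
  linarith

/-- ABOVE THE FIXED POINT the iterates tend to `+∞` (`r > 1`): the tower refines without bound. -/
theorem affine_iter_tendsto_atTop {r c : ℝ} (hr : 1 < r) {x : ℕ → ℝ} (hx : ∀ k, x (k + 1) = r * x k + c)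
    (h0 : c / (1 - r) < x 0) : Filter.Tendsto x Filter.atTop Filter.atTop := by
  have hd : 0 < x 0 - c / (1 - r) := by linarith
  have h1 : Filter.Tendsto (fun k : ℕ => r ^ k * (x 0 - c / (1 - r))) Filter.atTop Filter.atTop :=
    (tendsto_pow_atTop_atTop_of_one_lt hr).atTop_mul_const hd
  have h2 : Filter.Tendsto (fun k : ℕ => c / (1 - r) + r ^ k * (x 0 - c / (1 - r))) Filter.atTop Filter.atTop :=
    Filter.tendsto_atTop_add_const_left _ _ h1
  refine Filter.tendsto_atTop_mono (fun k => ?_) h2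
  exact affine_iter_ge (ne_of_gt hr) hx k

/-- BELOW THE FIXED POINT the iterates decrease strictly (`r > 1`): a would-be tower started under
threshold coarsens level by level — the heredity constant's only bite. -/
theorem affine_iter_strictAnti {r c : ℝ} (hr : 1 < r) {x : ℕ → ℝ} (hx : ∀ k, x (k + 1) = r * x k + c)
    (h0 : x 0 < c / (1 - r)) : StrictAnti x := by
  apply strictAnti_nat_of_succ_lt
  intro k
  have e := affine_iter_eq (ne_of_gt hr) hx k
  have hk : x k < c / (1 - r) := by
    have : r ^ k * (x 0 - c / (1 - r)) < 0 := mul_neg_of_pos_of_neg (pow_pos (by linarith) k) (by linarith)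
    linarith
  have h1r : (1 - r) ≠ 0 := ne_of_lt (by linarith)
  have key : (r - 1) * (x k - c / (1 - r)) = (r - 1) * x k + c := by
    field_simp
    ring
  have hneg : (r - 1) * (x k - c / (1 - r)) < 0 := mul_neg_of_pos_of_neg (by linarith) (by linarith)
  rw [hx k]
  linarith

end AffineRecursion

section Dictionary

/-! ## §2 The dictionary identities (all symbols literal; `N ^ β` is `Real.rpow`) -/

/-- CHILD FREQUENCY: Burgers diameter `2 (ν/σ*)^{1/2}` at `ν = 1`, `σ* = θ A_k`, `A_k = N^β` gives
`N_{k+1} = 1/δ_{k+1} = (√θ/2) · N^{β/2}`. -/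
theorem childFreq_eq {θ N : ℝ} (hθ : 0 < θ) (hN : 0 < N) (β : ℝ) :
    1 / (2 * Real.sqrt (1 / (θ * N ^ β))) = Real.sqrt θ / 2 * N ^ (β / 2) := by
  have hNβ : 0 < N ^ β := Real.rpow_pos_of_pos hN β
  have hsθ : 0 < Real.sqrt θ := Real.sqrt_pos.mpr hθ
  have hhalf : N ^ (β / 2) = Real.sqrt (N ^ β) := by
    rw [Real.sqrt_eq_rpow, ← Real.rpow_mul hN.le]
    ring_nf
  rw [hhalf, one_div (θ * N ^ β), Real.sqrt_inv, Real.sqrt_mul hθ.le]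
  have hsN : 0 < Real.sqrt (N ^ β) := Real.sqrt_pos.mpr hNβ
  field_simp

/-- In logarithms the child frequency is the AFFINE image of the parent's:
`log N_{k+1} = (β/2) log N_k + log(√θ/2)` — §1 applies with `r = β/2`, `c = log(√θ/2)`. -/
theorem log_childFreq {θ N : ℝ} (hθ : 0 < θ) (hN : 0 < N) (β : ℝ) :
    Real.log (Real.sqrt θ / 2 * N ^ (β / 2)) = β / 2 * Real.log N + Real.log (Real.sqrt θ / 2) := by
  have hsθ : 0 < Real.sqrt θ / 2 := by positivity
  have hNβ : 0 < N ^ (β / 2) := Real.rpow_pos_of_pos hN _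
  rw [Real.log_mul hsθ.ne' hNβ.ne', Real.log_rpow hN]
  ring

/-- CHILD RADIUS FACTOR: `δ(θ A) = θ^{-1/2} · δ(A)` for the Burgers diameter `δ(A) = 2 (ν/A)^{1/2}` —
the child is fatter by `1/√θ` and nothing else changes in the radius law. -/
theorem childRadius_eq {θ ν A : ℝ} (hθ : 0 < θ) (hνA : 0 ≤ ν / A) :
    2 * Real.sqrt (ν / (θ * A)) = (Real.sqrt θ)⁻¹ * (2 * Real.sqrt (ν / A)) := by
  have hsθ : 0 < Real.sqrt θ := Real.sqrt_pos.mpr hθ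
  have h : ν / (θ * A) = (ν / A) / θ := by
    rw [mul_comm, ← div_div]
  rw [h, Real.sqrt_div hνA, Real.sqrt_eq_rpow]
  field_simp

/-- TRAPPING ONLY EASIER: Palasek's `N_{k+1}² ≤ ¼ A_k` holds on the θ-schedule for every `θ ≤ 1`
(`((√θ/2) N^{β/2})² = (θ/4) N^β`). -/
theorem trapping_le {θ N : ℝ} (hθ : 0 ≤ θ) (hθ1 : θ ≤ 1) (hN : 0 < N) (β : ℝ) :
    (Real.sqrt θ / 2 * N ^ (β / 2)) ^ 2 ≤ 1 / 4 * N ^ β := by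
  have hsq : (N ^ (β / 2)) ^ 2 = N ^ β := by
    rw [← Real.rpow_natCast, ← Real.rpow_mul hN.le]
    norm_num
  have hθsq : Real.sqrt θ ^ 2 = θ := Real.sq_sqrt hθ
  have hNβ : 0 < N ^ β := Real.rpow_pos_of_pos hN β
  calc (Real.sqrt θ / 2 * N ^ (β / 2)) ^ 2 = θ / 4 * N ^ β := by rw [mul_pow, div_pow, hsq, hθsq]; norm_num
    _ ≤ 1 / 4 * N ^ β := by nlinarith

/-- … with equality exactly on the nominal schedule `θ = 1`: `((1/2) N^{β/2})² = ¼ N^β`. -/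
theorem trapping_eq_nominal {N : ℝ} (hN : 0 < N) (β : ℝ) :
    ((1 : ℝ) / 2 * N ^ (β / 2)) ^ 2 = 1 / 4 * N ^ β := by
  have hsq : (N ^ (β / 2)) ^ 2 = N ^ β := by
    rw [← Real.rpow_natCast, ← Real.rpow_mul hN.le]
    norm_num
  rw [mul_pow, hsq]
  norm_num

/-- THE FIXED POINT IN CLOSED FORM: with `r = β/2`, `c = log(√θ/2)` (`θ > 0`, `β ≠ 2`),
`c/(1−r) = log(4/θ)/(β−2)`. -/
theorem fixedPoint_eq {θ β : ℝ} (hθ : 0 < θ) (hβ : β ≠ 2) :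
    Real.log (Real.sqrt θ / 2) / (1 - β / 2) = Real.log (4 / θ) / (β - 2) := by
  have hsθ : 0 < Real.sqrt θ := Real.sqrt_pos.mpr hθ
  have h1 : Real.log (Real.sqrt θ / 2) = Real.log θ / 2 - Real.log 2 := by
    rw [Real.log_div hsθ.ne' (by norm_num), Real.log_sqrt hθ.le]
  have h2 : Real.log (4 / θ) = 2 * Real.log 2 - Real.log θ := by
    rw [Real.log_div (by norm_num) hθ.ne']
    have : Real.log (4 : ℝ) = 2 * Real.log 2 := by
      rw [show (4 : ℝ) = 2 ^ 2 by norm_num, Real.log_pow]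
      norm_num
    rw [this]
  have hβ' : β - 2 ≠ 0 := sub_ne_zero.mpr hβ
  have hβ'' : 1 - β / 2 ≠ 0 := by
    intro h
    apply hβ
    linarith
  rw [h1, h2, div_eq_div_iff hβ'' hβ']
  ring

/-- THE THRESHOLD AS A FREQUENCY: `exp(L_θ) = (4/θ)^{1/(β−2)}` — the θ-schedule refines iff the base
frequency exceeds this (`N₀ > 4^{1/(β−2)}` at `θ = 1`). -/
theorem exp_fixedPoint_eq {θ β : ℝ} (hθ : 0 < θ) :
    Real.exp (Real.log (4 / θ) / (β - 2)) = (4 / θ) ^ (1 / (β - 2)) := by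
  have h4θ : 0 < 4 / θ := by positivity
  rw [Real.rpow_def_of_pos h4θ, div_eq_mul_one_div]

/-- THE THRESHOLD AS A REYNOLDS NUMBER: for `β > 2` and `N > 0`,
`L_θ < log N ⇔ 4/θ < N^{β−2} = Re` — the heredity constant raises the minimum host Reynolds number
of the marginal schedule from `4` to `4/θ` and does nothing else. -/
theorem above_threshold_iff {θ β N : ℝ} (hθ : 0 < θ) (hβ : 2 < β) (hN : 0 < N) :
    Real.log (4 / θ) / (β - 2) < Real.log N ↔ 4 / θ < N ^ (β - 2) := by
  have h4θ : 0 < 4 / θ := by positivity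
  have hβ' : 0 < β - 2 := sub_pos.mpr hβ
  have hNβ : 0 < N ^ (β - 2) := Real.rpow_pos_of_pos hN _
  rw [div_lt_iff₀ hβ', mul_comm (Real.log N) (β - 2), ← Real.log_rpow hN, Real.log_lt_log_iff h4θ hNβ]

/-- AMOUNT ONLY SMALLER: the flux the fatter, coarser child must gather scales like
`N_{k+1}^{β−2}`; on the θ-schedule `((√θ/2) M)^{β−2} = θ^{(β−2)/2} · ((1/2) M)^{β−2}` (`M = N_k^{β/2} ≥ 0`) … -/
theorem amount_factor_eq {θ M β : ℝ} (hθ : 0 ≤ θ) (hM : 0 ≤ M) :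
    (Real.sqrt θ / 2 * M) ^ (β - 2) = θ ^ ((β - 2) / 2) * ((1 / 2) * M) ^ (β - 2) := by
  have hsθ : 0 ≤ Real.sqrt θ := Real.sqrt_nonneg θ
  have hhalfM : 0 ≤ (1 : ℝ) / 2 * M := by positivity
  have h1 : Real.sqrt θ / 2 * M = Real.sqrt θ * ((1 / 2) * M) := by ring
  rw [h1, Real.mul_rpow hsθ hhalfM, Real.sqrt_eq_rpow, ← Real.rpow_mul hθ]
  congr 1
  ring_nf

/-- … and the factor `θ^{(β−2)/2}` is `≤ 1` for `θ ≤ 1`, `β ≥ 2`: the θ-schedule never asks the child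
for MORE host flux than the nominal one (`m_k(θ) = θ^{(β−2)/2} m_k ≤ m_k`; `= 0.684 m_k` at
`θ = 3/20`, `β* = 12/5`). -/
theorem amount_factor_le_one {θ β : ℝ} (hθ : 0 ≤ θ) (hθ1 : θ ≤ 1) (hβ : 2 ≤ β) :
    θ ^ ((β - 2) / 2) ≤ 1 :=
  Real.rpow_le_one hθ hθ1 (by linarith)

end Dictionary

section Numbers

/-! ## §3 The numbers of record at `β* = 12/5` (`1/(β*−2) = 5/2`, `N = Re^{5/2}`) -/

/-- `1/(β* − 2) = 5/2` at `β* = 12/5`. -/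
theorem inv_beta_star_sub_two : 1 / ((12 : ℝ) / 5 - 2) = 5 / 2 := by norm_num

/-- Reynolds thresholds `4/θ`: `4` (nominal), `80/3 < 27` (one tube, `θ = 3/20`), `40/3 < 14`
(co-rotating pair, `θ = 3/10`), `20/3 < 7` (four tubes, `θ = 3/5`, HEUR constant) — all far below the
P-TOWER-1′ hosts' `Re_{k−1} = √2·R ≥ 424`. -/
theorem re_thresholds :
    (4 : ℝ) / 1 = 4 ∧ (4 : ℝ) / (3 / 20) = 80 / 3 ∧ (80 : ℝ) / 3 < 27 ∧
      (4 : ℝ) / (3 / 10) = 40 / 3 ∧ (40 : ℝ) / 3 < 14 ∧ (4 : ℝ) / (3 / 5) = 20 / 3 ∧ (20 : ℝ) / 3 < 7 := by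
  norm_num

/-- The nominal frequency threshold at `β* = 12/5`: `4^{5/2} = 32`. -/
theorem nominal_freq_threshold : (4 : ℝ) ^ ((5 : ℝ) / 2) = 32 := by
  rw [show (4 : ℝ) = 2 ^ (2 : ℝ) by norm_num, ← Real.rpow_mul (by norm_num : (0 : ℝ) ≤ 2)]
  norm_num

/-- The one-tube frequency threshold at `β* = 12/5`: `(80/3)^{5/2} ∈ (3672, 3673)` — the SAME statement
as `Re > 80/3`, a large number only because `N = Re^{5/2}`. -/
theorem one_tube_freq_threshold :
    3672 < ((80 : ℝ) / 3) ^ ((5 : ℝ) / 2) ∧ ((80 : ℝ) / 3) ^ ((5 : ℝ) / 2) < 3673 := by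
  have hpos : 0 < ((80 : ℝ) / 3) ^ ((5 : ℝ) / 2) := Real.rpow_pos_of_pos (by norm_num) _
  have hsq : (((80 : ℝ) / 3) ^ ((5 : ℝ) / 2)) ^ 2 = (80 / 3) ^ (5 : ℕ) := by
    rw [← Real.rpow_natCast, ← Real.rpow_mul (by norm_num : (0 : ℝ) ≤ 80 / 3)]
    norm_num
  constructor
  · have h : (3672 : ℝ) ^ 2 < (((80 : ℝ) / 3) ^ ((5 : ℝ) / 2)) ^ 2 := by
      rw [hsq]
      norm_num
    exact lt_of_pow_lt_pow_left₀ 2 hpos.le h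
  · have h : (((80 : ℝ) / 3) ^ ((5 : ℝ) / 2)) ^ 2 < (3673 : ℝ) ^ 2 := by
      rw [hsq]
      norm_num
    exact lt_of_pow_lt_pow_left₀ 2 (by norm_num) h

/-- The child-radius factor at `θ = 3/20`: `1/√θ = √(20/3) ∈ (2.58, 2.59)` («fatter child by ≤ ×2.6»). -/
theorem one_tube_radius_factor :
    2.58 < Real.sqrt (20 / 3) ∧ Real.sqrt (20 / 3) < 2.59 := by
  constructor
  · rw [Real.lt_sqrt (by norm_num)]
    norm_num
  · rw [Real.sqrt_lt' (by norm_num)]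
    norm_num

/-- The AMOUNT factor at `θ = 3/20`, `β* = 12/5` is `(3/20)^{1/5}`; its fifth power is `3/20`, and
`0.68^5 < 3/20 < 0.69^5` places it in `(0.68, 0.69)`. -/
theorem one_tube_amount_factor :
    ((3 : ℝ) / 20) ^ (((12 : ℝ) / 5 - 2) / 2) = (3 / 20) ^ ((1 : ℝ) / 5) ∧
      ((3 : ℝ) / 20) ^ ((1 : ℝ) / 5) ∈ Set.Ioo (0.68 : ℝ) 0.69 := by
  constructor
  · norm_num
  · have hpos : 0 < ((3 : ℝ) / 20) ^ ((1 : ℝ) / 5) := Real.rpow_pos_of_pos (by norm_num) _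
    have h5 : (((3 : ℝ) / 20) ^ ((1 : ℝ) / 5)) ^ 5 = 3 / 20 := by
      rw [← Real.rpow_natCast, ← Real.rpow_mul (by norm_num : (0 : ℝ) ≤ 3 / 20)]
      norm_num
    constructor
    · have h : (0.68 : ℝ) ^ 5 < (((3 : ℝ) / 20) ^ ((1 : ℝ) / 5)) ^ 5 := by
        rw [h5]
        norm_num
      exact lt_of_pow_lt_pow_left₀ 5 hpos.le h
    · have h : (((3 : ℝ) / 20) ^ ((1 : ℝ) / 5)) ^ 5 < (0.69 : ℝ) ^ 5 := by
        rw [h5]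
        norm_num
      exact lt_of_pow_lt_pow_left₀ 5 (by norm_num) h

end Numbers

section LevelDependent

/-! ## §4 Level-dependent heredity constants and formation time (refuter2 K-READ of E.3 «LEVEL-2», STATUS l.969: W3 «θ = infimum over levels», W2 «×1/θ per level»)

With a site-dependent constant `θ_k` per level the recursion is `x (k+1) = r · x k + c k`, `c k = log(√θ_k/2)`.
Its solution is MONOTONE in every `c k`, so the constant recursion at `c₀ = log(√θ_inf/2)`, `θ_inf ≤ θ_k`, is a
lower barrier: the sufficient refinement threshold is `Re₀ > 4/θ_inf`. Burgers equilibration at the offered strain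
`σ* = θ A_k` takes `1/(θ A_k) = (1/θ)·(1/A_k)` parent-strain times: a factor `1/θ` per level, a constant. -/

/-- `c(θ) = log(√θ/2)` is monotone in `θ`: a larger heredity constant gives a larger affine shift. -/
theorem logShift_mono {θ₀ θ : ℝ} (h0 : 0 < θ₀) (h : θ₀ ≤ θ) :
    Real.log (Real.sqrt θ₀ / 2) ≤ Real.log (Real.sqrt θ / 2) := by
  have hs0 : 0 < Real.sqrt θ₀ / 2 := by positivity
  exact Real.log_le_log hs0 (by gcongr)

/-- COMPARISON (W3): if `c₀ ≤ c k` for every level and `r ≥ 0`, the constant-`c₀` iterates from a start `y 0 ≤ x 0`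
stay below the level-dependent ones: `y k ≤ x k`. -/
theorem affine_iter_mono {r : ℝ} (hr : 0 ≤ r) {c : ℕ → ℝ} {c₀ : ℝ} (hc : ∀ k, c₀ ≤ c k) {x y : ℕ → ℝ}
    (hx : ∀ k, x (k + 1) = r * x k + c k) (hy : ∀ k, y (k + 1) = r * y k + c₀) (h0 : y 0 ≤ x 0) (k : ℕ) :
    y k ≤ x k := by
  induction k with
  | zero => exact h0
  | succ k ih =>
    rw [hx k, hy k]
    have := mul_le_mul_of_nonneg_left ih hr
    linarith [hc k]

/-- … hence ABOVE THE `inf`-THRESHOLD `c₀/(1−r) < x 0` (i.e. `Re₀ > 4/θ_inf`) the level-dependent schedule also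
refines without bound (`r > 1`). -/
theorem affine_iter_tendsto_atTop_of_le {r : ℝ} (hr : 1 < r) {c : ℕ → ℝ} {c₀ : ℝ} (hc : ∀ k, c₀ ≤ c k)
    {x : ℕ → ℝ} (hx : ∀ k, x (k + 1) = r * x k + c k) (h0 : c₀ / (1 - r) < x 0) :
    Filter.Tendsto x Filter.atTop Filter.atTop := by
  let y : ℕ → ℝ := fun k => Nat.rec (x 0) (fun _ yk => r * yk + c₀) k
  have hy : ∀ k, y (k + 1) = r * y k + c₀ := fun _ => rfl
  have hy0 : y 0 = x 0 := rfl
  have hty : Filter.Tendsto y Filter.atTop Filter.atTop :=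
    affine_iter_tendsto_atTop hr hy (by rw [hy0]; exact h0)
  exact Filter.tendsto_atTop_mono
    (fun k => affine_iter_mono (le_of_lt (lt_trans zero_lt_one hr)) hc hx hy (le_of_eq hy0) k) hty

/-- FORMATION TIME PER LEVEL (W2): equilibration at the offered strain `θ A` takes `1/(θA) = (1/θ)(1/A)` … -/
theorem formation_time_eq (θ A : ℝ) : 1 / (θ * A) = (1 / θ) * (1 / A) := by
  rw [one_div_mul_one_div]

/-- … which is at least the nominal `1/A` for `θ ≤ 1` (`θ, A > 0`): slower by the constant factor `1/θ` (`≈ 6.7` at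
`θ = 3/20`), never by an exponent … -/
theorem formation_time_ge {θ A : ℝ} (hθ : 0 < θ) (hθ1 : θ ≤ 1) (hA : 0 < A) : 1 / A ≤ 1 / (θ * A) := by
  rw [div_le_div_iff₀ hA (mul_pos hθ hA)]
  nlinarith

/-- … and summed down the tower the total formation time is exactly `1/θ` times the nominal sum `Σ 1/A_k`
(finite whenever the nominal one is). -/
theorem formation_time_sum (θ : ℝ) (A : ℕ → ℝ) (n : ℕ) :
    ∑ k ∈ Finset.range n, 1 / (θ * A k) = (1 / θ) * ∑ k ∈ Finset.range n, 1 / A k := by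
  rw [Finset.mul_sum]
  refine Finset.sum_congr rfl (fun k _ => ?_)
  rw [one_div_mul_one_div]

/-- The numbers: `1/θ = 20/3 ∈ (6.6, 6.7)` at `θ = 3/20`, `10/3` at `3/10`. -/
theorem formation_time_factors : (1 : ℝ) / (3 / 20) = 20 / 3 ∧ (6.6 : ℝ) < 20 / 3 ∧ (20 : ℝ) / 3 < 6.7 ∧ (1 : ℝ) / (3 / 10) = 10 / 3 := by
  norm_num

end LevelDependent

end Summit.NavierStokesRegularity.FluidComputer.HeredityConstantLedger
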